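import Literature.Algebra.EuclideanLattices.LLLAlgorithm
import Literature.Algebra.EuclideanLattices.LLLProofs
import HarnessLib

/-!
# The loop invariant of the LLL algorithm: discharge of `isLLLReduced_of_halted`

Trunk: Lattice; sibling proof file of `LLLAlgorithm.lean` (LLL82 Fig. 1 as the step function
`Literature.Algebra.EuclideanLattices.lllStep`). We prove the loop invariant of A. K. Lenstra, H. W. Lenstra Jr.,
L. Lovász, *Factoring polynomials with rational coefficients*, Math. Ann. 261 (1982), §1
(discussion of Fig. 1), in the numbered form of M. R. Bremner, *Lattice Basis Reduction*
(CRC 2011), Lemma 4.13: at a state with index `k`, `|μᵢⱼ| ≤ 1/2` for `j < i < k` and the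
Lovász test holds at `(i, i+1)` for `i + 1 < k`. Consequently a halted iterate (`n ≤ k`) carries
an LLL-reduced family:

* `Literature.Lattice.isLLLReduced_of_halted_holds : isLLLReduced_of_halted φ` for every measuring map
  `φ : V →+ E` (no independence hypothesis).

On the way, reusable Gram–Schmidt lemmas (general index type): the characterisation of `b*ᵢ`
as the unique vector `v` with `v - bᵢ ∈ Uᵢ := span {bⱼ : j < i}` and `v ⊥ Uᵢ`
(`eq_gramSchmidt_of_sub_mem_span`), hence `b*ᵢ` depends only on `b₀, …, bᵢ`
(`gramSchmidt_congr_of_forall_le`) and is unchanged by the row operation `bₖ ← bₖ - c • bₗ`,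
`l < k` (`gramSchmidt_update_sub_smul`, Bremner Lemma 4.11), with the corresponding update of
the coefficients `μₖⱼ ← μₖⱼ - c μₗⱼ` (`gsCoeff_update_sub_smul_self`); and the effect of the
procedures `reduce(k, l)` / the size-reduction loop of `LLLAlgorithm.lean` on the measured family
(`lllSizeReduceFrom_spec`).

## References

* A. K. Lenstra, H. W. Lenstra Jr., L. Lovász, Math. Ann. 261 (1982), §1, Fig. 1.
* M. R. Bremner, *Lattice Basis Reduction*, CRC Press 2011, Lemmas 4.11 and 4.13.
-/

noncomputable section
namespace Literature.Algebra.EuclideanLattices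

open InnerProductSpace Function Submodule Finset
open scoped RealInnerProductSpace

section GS

variable {E : Type*} [NormedAddCommGroup E] [InnerProductSpace ℝ E]
variable {ι : Type*} [LinearOrder ι] [LocallyFiniteOrderBot ι] [WellFoundedLT ι]

/-- `b*ᵢ - bᵢ` lies in the span of the earlier vectors. [folklore] -/
theorem gramSchmidt_sub_self_mem_span (f : ι → E) (i : ι) :
    gramSchmidt ℝ f i - f i ∈ span ℝ (f '' Set.Iio i) := by
  rw [gramSchmidt_def ℝ f i, sub_sub_cancel_left, neg_mem_iff]
  refine Submodule.sum_mem _ fun j hj => ?_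
  rw [starProjection_singleton]
  refine smul_mem _ _ ?_
  have hj' : j < i := Finset.mem_Iio.1 hj
  exact span_mono (Set.image_mono (Set.Iic_subset_Iio.2 hj')) (gramSchmidt_mem_span ℝ f le_rfl)

/-- `b*ᵢ` is orthogonal to the span of the earlier vectors. [folklore] -/
theorem inner_gramSchmidt_eq_zero_of_mem_span (f : ι → E) {i : ι} {u : E}
    (hu : u ∈ span ℝ (f '' Set.Iio i)) : ⟪u, gramSchmidt ℝ f i⟫ = 0 := by
  induction hu using Submodule.span_induction with
  | mem x hx =>
    obtain ⟨j, hj, rfl⟩ := hx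
    rw [real_inner_comm]
    exact gramSchmidt_inv_triangular ℝ f hj
  | zero => exact inner_zero_left _
  | add x y _ _ hx hy => rw [inner_add_left, hx, hy, add_zero]
  | smul c x _ hx => rw [real_inner_smul_left, hx, mul_zero]

/-- **Characterisation of the Gram–Schmidt vectors**: `b*ᵢ` is the unique vector `v` with
`v - bᵢ` in the span `Uᵢ` of the earlier vectors and `v ⊥ Uᵢ`. [folklore] -/
theorem eq_gramSchmidt_of_sub_mem_span (f : ι → E) {i : ι} {v : E}
    (h₁ : v - f i ∈ span ℝ (f '' Set.Iio i))
    (h₂ : ∀ u ∈ span ℝ (f '' Set.Iio i), ⟪u, v⟫ = 0) : v = gramSchmidt ℝ f i := by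
  have hd : v - gramSchmidt ℝ f i ∈ span ℝ (f '' Set.Iio i) := by
    have := sub_mem h₁ (gramSchmidt_sub_self_mem_span f i)
    rwa [sub_sub_sub_cancel_right] at this
  have h0 : ⟪v - gramSchmidt ℝ f i, v - gramSchmidt ℝ f i⟫ = 0 := by
    rw [inner_sub_right, h₂ _ hd, inner_gramSchmidt_eq_zero_of_mem_span f hd, sub_zero]
  rwa [real_inner_self_eq_norm_sq, sq_eq_zero_iff, norm_eq_zero, sub_eq_zero] at h0

/-- `b*ᵢ` depends only on `b₀, …, bᵢ`. [folklore] -/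
theorem gramSchmidt_congr_of_forall_le {f g : ι → E} {i : ι} (h : ∀ j ≤ i, f j = g j) :
    gramSchmidt ℝ f i = gramSchmidt ℝ g i := by
  have hs : f '' Set.Iio i = g '' Set.Iio i :=
    Set.image_congr fun j hj => h j (le_of_lt hj)
  apply eq_gramSchmidt_of_sub_mem_span
  · rw [← h i le_rfl, ← hs]; exact gramSchmidt_sub_self_mem_span f i
  · intro u hu; rw [← hs] at hu; exact inner_gramSchmidt_eq_zero_of_mem_span f hu

/-- `μᵢⱼ` depends only on `b₀, …, b_{max i j}`. [folklore] -/
theorem gsCoeff_congr_of_forall_le {f g : ι → E} {i j : ι} (h : ∀ l ≤ max i j, f l = g l) :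
    gsCoeff f i j = gsCoeff g i j := by
  rw [gsCoeff, gsCoeff, h i (le_max_left _ _),
    gramSchmidt_congr_of_forall_le (i := j) fun l hl => h l (hl.trans (le_max_right _ _))]

omit [LocallyFiniteOrderBot ι] [WellFoundedLT ι] in
/-- The spans of all prefixes are unchanged by `bₖ ← bₖ - c • bₗ` with `l < k`. [folklore] -/
theorem span_image_Iio_update_sub_smul (f : ι → E) {k l : ι} (hlk : l < k) (c : ℝ) (i : ι) :
    span ℝ (update f k (f k - c • f l) '' Set.Iio i) = span ℝ (f '' Set.Iio i) := by
  by_cases hki : k < i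
  · have hli : l ∈ Set.Iio i := hlk.trans hki
    apply le_antisymm
    · refine span_le.2 ?_
      rintro _ ⟨j, hj, rfl⟩
      by_cases hjk : j = k
      · subst hjk
        rw [update_self]
        exact sub_mem (subset_span ⟨j, hj, rfl⟩) (smul_mem _ _ (subset_span ⟨l, hli, rfl⟩))
      · rw [update_of_ne hjk]
        exact subset_span ⟨j, hj, rfl⟩
    · refine span_le.2 ?_
      rintro _ ⟨j, hj, rfl⟩
      by_cases hjk : j = k
      · subst hjk
        have hmem : update f j (f j - c • f l) j + c • update f j (f j - c • f l) l ∈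
            span ℝ (update f j (f j - c • f l) '' Set.Iio i) :=
          add_mem (subset_span ⟨j, hj, rfl⟩) (smul_mem _ _ (subset_span ⟨l, hli, rfl⟩))
        rwa [update_self, update_of_ne hlk.ne, sub_add_cancel] at hmem
      · rw [← update_of_ne hjk (f k - c • f l) f]
        exact subset_span ⟨j, hj, rfl⟩
  · congr 1
    refine Set.image_congr fun j hj => update_of_ne ?_ _ _
    exact fun h => hki (h ▸ hj)

/-- **Reduction lemma** (Bremner Lemma 4.11, `Z* = Y*`): the Gram–Schmidt vectors are unchanged
by `bₖ ← bₖ - c • bₗ` with `l < k`. [cite: Bremner2011, Lemma 4.11] -/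
theorem gramSchmidt_update_sub_smul (f : ι → E) {k l : ι} (hlk : l < k) (c : ℝ) :
    gramSchmidt ℝ (update f k (f k - c • f l)) = gramSchmidt ℝ f := by
  funext i
  symm
  apply eq_gramSchmidt_of_sub_mem_span
  · rw [span_image_Iio_update_sub_smul f hlk c i]
    by_cases hi : i = k
    · subst hi
      rw [update_self, show gramSchmidt ℝ f i - (f i - c • f l) =
        (gramSchmidt ℝ f i - f i) + c • f l by abel]
      exact add_mem (gramSchmidt_sub_self_mem_span f i)
        (smul_mem _ _ (subset_span ⟨l, hlk, rfl⟩))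
    · rw [update_of_ne hi]
      exact gramSchmidt_sub_self_mem_span f i
  · intro u hu
    rw [span_image_Iio_update_sub_smul f hlk c i] at hu
    exact inner_gramSchmidt_eq_zero_of_mem_span f hu

/-- Gram–Schmidt coefficients after `bₖ ← bₖ - c • bₗ` (`l < k`): rows `i ≠ k` are unchanged.
[cite: Bremner2011, Lemma 4.11 (N = EM)] -/
theorem gsCoeff_update_sub_smul_of_ne (f : ι → E) {k l : ι} (hlk : l < k) (c : ℝ) {i : ι}
    (hi : i ≠ k) (j : ι) : gsCoeff (update f k (f k - c • f l)) i j = gsCoeff f i j := by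
  rw [gsCoeff, gsCoeff, gramSchmidt_update_sub_smul f hlk, update_of_ne hi]

/-- Gram–Schmidt coefficients after `bₖ ← bₖ - c • bₗ` (`l < k`): row `k` becomes
`μₖⱼ - c μₗⱼ`. [cite: Bremner2011, Lemma 4.11 (N = EM)] -/
theorem gsCoeff_update_sub_smul_self (f : ι → E) {k l : ι} (hlk : l < k) (c : ℝ) (j : ι) :
    gsCoeff (update f k (f k - c • f l)) k j = gsCoeff f k j - c * gsCoeff f l j := by
  rw [gsCoeff, gsCoeff, gsCoeff, gramSchmidt_update_sub_smul f hlk, update_self, inner_sub_left,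
    real_inner_smul_left, sub_div, mul_div_assoc]

end GS

/-! ### The measured family under the elementary operations -/

section Measured

variable {E : Type*} [NormedAddCommGroup E] [InnerProductSpace ℝ E]
variable {V : Type*} [AddCommGroup V] (φ : V →+ E) {n : ℕ}

/-- Measuring commutes with the row operation `bₖ ← bₖ - r • bₗ`. [folklore] -/
theorem comp_update_sub_zsmul (b : Fin n → V) (k l : Fin n) (r : ℤ) :
    (⇑φ ∘ update b k (b k - r • b l)) =
      update (⇑φ ∘ b) k ((⇑φ ∘ b) k - (r : ℝ) • (⇑φ ∘ b) l) := by
  rw [comp_update]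
  congr 1
  simp only [comp_apply, map_sub, map_zsmul, Int.cast_smul_eq_zsmul]

/-- `reduce(k, l)` is a row operation `bₖ ← bₖ - c • bₗ` on the measured family (with `c = 0`
when nothing is done). [cite: LenstraLenstraLovasz1982, §1 Fig. 1 (∗)] -/
theorem exists_comp_lllSizeReduce_eq (b : Fin n → V) (k l : Fin n) :
    ∃ c : ℝ, (⇑φ ∘ lllSizeReduce φ b k l) =
      update (⇑φ ∘ b) k ((⇑φ ∘ b) k - c • (⇑φ ∘ b) l) := by
  unfold lllSizeReduce
  split_ifs
  · exact ⟨0, by simp⟩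
  · exact ⟨_, comp_update_sub_zsmul φ b k l _⟩

/-- `reduce(k, l)`, `l < k`, does not change the Gram–Schmidt vectors.
[cite: Bremner2011, Lemma 4.11] -/
theorem gramSchmidt_lllSizeReduce (b : Fin n → V) {k l : Fin n} (hlk : l < k) :
    gramSchmidt ℝ (⇑φ ∘ lllSizeReduce φ b k l) = gramSchmidt ℝ (⇑φ ∘ b) := by
  obtain ⟨c, hc⟩ := exists_comp_lllSizeReduce_eq φ b k l
  rw [hc, gramSchmidt_update_sub_smul _ hlk]

/-- `reduce(k, l)`, `l < k`, does not change the coefficients `μᵢⱼ` of the rows `i ≠ k`.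
[cite: Bremner2011, Lemma 4.11] -/
theorem gsCoeff_lllSizeReduce_of_ne (b : Fin n → V) {k l : Fin n} (hlk : l < k) {i : Fin n}
    (hi : i ≠ k) (j : Fin n) :
    gsCoeff (⇑φ ∘ lllSizeReduce φ b k l) i j = gsCoeff (⇑φ ∘ b) i j := by
  obtain ⟨c, hc⟩ := exists_comp_lllSizeReduce_eq φ b k l
  rw [hc, gsCoeff_update_sub_smul_of_ne _ hlk c hi]

/-- `reduce(k, l)`, `l < k`, does not change the coefficients `μₖⱼ` with `l < j`
(because `μₗⱼ = 0`). [cite: LenstraLenstraLovasz1982, §1 (discussion of Fig. 1)] -/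
theorem gsCoeff_lllSizeReduce_of_lt (b : Fin n → V) {k l : Fin n} (hlk : l < k) {j : Fin n}
    (hlj : l < j) : gsCoeff (⇑φ ∘ lllSizeReduce φ b k l) k j = gsCoeff (⇑φ ∘ b) k j := by
  obtain ⟨c, hc⟩ := exists_comp_lllSizeReduce_eq φ b k l
  rw [hc, gsCoeff_update_sub_smul_self _ hlk c, gsCoeff_eq_zero_of_lt_holds _ hlj, mul_zero,
    sub_zero]

/-- After `reduce(k, l)`, `l < k`: `|μₖₗ| ≤ 1/2`. (If `b*ₗ = 0` then `μₖₗ = 0` and nothing is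
done; otherwise `μₗₗ = 1` and `|μ - round μ| ≤ 1/2`.)
[cite: LenstraLenstraLovasz1982, §1 Fig. 1 (∗)] [cite: Bremner2011, Lemma 4.11] -/
theorem abs_gsCoeff_lllSizeReduce_le (b : Fin n → V) {k l : Fin n} (hlk : l < k) :
    |gsCoeff (⇑φ ∘ lllSizeReduce φ b k l) k l| ≤ 1 / 2 := by
  unfold lllSizeReduce
  split_ifs with h
  · exact h
  · rw [comp_update_sub_zsmul, gsCoeff_update_sub_smul_self _ hlk]
    have hne : gramSchmidt ℝ (⇑φ ∘ b) l ≠ 0 := by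
      intro h0
      apply h
      rw [gsCoeff, h0, inner_zero_right, zero_div, abs_zero]
      norm_num
    rw [gsCoeff_self_holds _ l hne, mul_one]
    exact abs_sub_round _

/-- The descending loop `reduce(k, a-1), …, reduce(k, 0)` (`a ≤ k`): Gram–Schmidt vectors and
the rows `i ≠ k` are unchanged, the coefficients `μₖⱼ` with `a ≤ j` are unchanged, and
`|μₖⱼ| ≤ 1/2` for `j < a` afterwards. [cite: LenstraLenstraLovasz1982, §1 (discussion of Fig. 1)] [cite: Bremner2011, Lemma 4.13 (proof)] -/
theorem lllSizeReduceFrom_spec (k : Fin n) :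
    ∀ (a : ℕ) (ha : a ≤ n) (_ : a ≤ k.val) (b : Fin n → V),
      gramSchmidt ℝ (⇑φ ∘ lllSizeReduceFrom φ k a ha b) = gramSchmidt ℝ (⇑φ ∘ b) ∧
      (∀ i : Fin n, i ≠ k → ∀ j,
        gsCoeff (⇑φ ∘ lllSizeReduceFrom φ k a ha b) i j = gsCoeff (⇑φ ∘ b) i j) ∧
      (∀ j : Fin n, a ≤ j.val →
        gsCoeff (⇑φ ∘ lllSizeReduceFrom φ k a ha b) k j = gsCoeff (⇑φ ∘ b) k j) ∧
      (∀ j : Fin n, j.val < a → |gsCoeff (⇑φ ∘ lllSizeReduceFrom φ k a ha b) k j| ≤ 1 / 2)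
  | 0, _, _, b => ⟨rfl, fun _ _ _ => rfl, fun _ _ => rfl, fun j hj => absurd hj (Nat.not_lt_zero _)⟩
  | a + 1, ha, hak, b => by
    have hlk : (⟨a, ha⟩ : Fin n) < k := Fin.mk_lt_of_lt_val hak
    obtain ⟨h1, h2, h3, h4⟩ :=
      lllSizeReduceFrom_spec k a (Nat.le_of_succ_le ha) (Nat.le_of_succ_le hak)
        (lllSizeReduce φ b k ⟨a, ha⟩)
    rw [lllSizeReduceFrom]
    refine ⟨h1.trans (gramSchmidt_lllSizeReduce φ b hlk),
      fun i hi j => (h2 i hi j).trans (gsCoeff_lllSizeReduce_of_ne φ b hlk hi j),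
      fun j hj => (h3 j (Nat.le_of_succ_le hj)).trans
        (gsCoeff_lllSizeReduce_of_lt φ b hlk (Fin.mk_lt_of_lt_val hj)),
      fun j hj => ?_⟩
    rcases Nat.lt_succ_iff_lt_or_eq.1 hj with hj | hj
    · exact h4 j hj
    · rw [h3 j hj.ge]
      obtain rfl : j = ⟨a, ha⟩ := Fin.ext hj
      exact abs_gsCoeff_lllSizeReduce_le φ b hlk

end Measured

/-! ### The loop invariant -/

section Invariant

variable {E : Type*} [NormedAddCommGroup E] [InnerProductSpace ℝ E]
variable {V : Type*} [AddCommGroup V] (φ : V →+ E) {n : ℕ}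

/-- The Lovász test at `(j, k)`, `j ≤ k`, depends only on `b₀, …, bₖ`. [folklore] -/
theorem lovaszTestAt_congr {δ : ℝ} {f g : Fin n → E} {j k : Fin n} (hjk : j ≤ k)
    (h : ∀ l ≤ k, f l = g l) : LovaszTestAt δ f j k ↔ LovaszTestAt δ g j k := by
  unfold LovaszTestAt
  rw [gramSchmidt_congr_of_forall_le (i := j) fun l hl => h l (hl.trans hjk),
    gramSchmidt_congr_of_forall_le (i := k) h,
    gsCoeff_congr_of_forall_le (f := f) (g := g) (i := k) (j := j)
      fun l hl => h l (by rwa [max_eq_left hjk] at hl)]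

/-- **The loop invariant of LLL82 Fig. 1** (Bremner Lemma 4.13): at a state with index `k`,
`|μᵢⱼ| ≤ 1/2` for `j < i < k` and the Lovász test holds at `(i, i+1)` for `i + 1 < k`; it holds
at the start state and is preserved by `lllStep`. Here: preservation.
[cite: LenstraLenstraLovasz1982, §1 Fig. 1] [cite: Bremner2011, Lemma 4.13] -/
theorem lllStep_invariant (δ : ℝ) (s : LLLState n V)
    (ha : ∀ i j : Fin n, j < i → (i : ℕ) < s.k → |gsCoeff (⇑φ ∘ s.b) i j| ≤ 1 / 2)
    (hb : ∀ (i : Fin n) (h : (i : ℕ) + 1 < n), (i : ℕ) + 1 < s.k →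
      LovaszTestAt δ (⇑φ ∘ s.b) i ⟨i + 1, h⟩) :
    (∀ i j : Fin n, j < i → (i : ℕ) < (lllStep φ δ s).k →
        |gsCoeff (⇑φ ∘ (lllStep φ δ s).b) i j| ≤ 1 / 2) ∧
      (∀ (i : Fin n) (h : (i : ℕ) + 1 < n), (i : ℕ) + 1 < (lllStep φ δ s).k →
        LovaszTestAt δ (⇑φ ∘ (lllStep φ δ s).b) i ⟨i + 1, h⟩) := by
  unfold lllStep
  by_cases hk : 0 < s.k ∧ s.k < n
  · rw [dif_pos hk]
    dsimp only
    -- notation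
    set k : Fin n := ⟨s.k, hk.2⟩ with hkdef
    set j₀ : Fin n := ⟨s.k - 1, by omega⟩ with hj₀def
    have hjk : j₀ < k := Fin.mk_lt_mk.2 (by omega)
    set b₁ := lllSizeReduce φ s.b k j₀ with hb₁def
    -- facts about `b₁ = reduce(k, k-1)`
    have hGS₁ : gramSchmidt ℝ (⇑φ ∘ b₁) = gramSchmidt ℝ (⇑φ ∘ s.b) :=
      gramSchmidt_lllSizeReduce φ s.b hjk
    have hrow₁ : ∀ i : Fin n, i ≠ k → ∀ j, gsCoeff (⇑φ ∘ b₁) i j = gsCoeff (⇑φ ∘ s.b) i j :=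
      fun i hi j => gsCoeff_lllSizeReduce_of_ne φ s.b hjk hi j
    have hμ₁ : |gsCoeff (⇑φ ∘ b₁) k j₀| ≤ 1 / 2 := abs_gsCoeff_lllSizeReduce_le φ s.b hjk
    have hLov₁ : ∀ (i : Fin n) (h : (i : ℕ) + 1 < n), (i : ℕ) + 1 < s.k →
        LovaszTestAt δ (⇑φ ∘ b₁) i ⟨i + 1, h⟩ := by
      intro i h hi
      have := hb i h hi
      unfold LovaszTestAt at this ⊢
      rwa [hGS₁, hrow₁ _ (fun h' => by have := congrArg Fin.val h'; simp [hkdef] at this; omega)]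
    by_cases ht : LovaszTestAt δ (⇑φ ∘ b₁) j₀ k
    · rw [if_pos ht]
      dsimp only
      obtain ⟨h1, h2, h3, h4⟩ := lllSizeReduceFrom_spec φ k (k.val - 1) (by omega) (by omega) b₁
      change gramSchmidt ℝ (⇑φ ∘ lllSizeReduceBelow φ b₁ k) = _ at h1
      change ∀ i : Fin n, i ≠ k → ∀ j, gsCoeff (⇑φ ∘ lllSizeReduceBelow φ b₁ k) i j = _ at h2
      change ∀ j : Fin n, k.val - 1 ≤ j.val → gsCoeff (⇑φ ∘ lllSizeReduceBelow φ b₁ k) k j = _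
        at h3
      change ∀ j : Fin n, j.val < k.val - 1 → |gsCoeff (⇑φ ∘ lllSizeReduceBelow φ b₁ k) k j| ≤ _
        at h4
      refine ⟨fun i j hji hi => ?_, fun i h hi => ?_⟩
      · rcases Nat.lt_succ_iff_lt_or_eq.1 hi with hi | hi
        · rw [h2 i (fun h' => by have := congrArg Fin.val h'; simp [hkdef] at this; omega),
            hrow₁ i (fun h' => by have := congrArg Fin.val h'; simp [hkdef] at this; omega)]
          exact ha i j hji hi
        · obtain rfl : i = k := Fin.ext hi
          by_cases hj : j.val < s.k - 1
          · exact h4 j hj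
          · obtain rfl : j = j₀ := Fin.ext (by
              have := Fin.lt_def.1 hji; simp [hj₀def]; omega)
            rw [h3 _ le_rfl]
            exact hμ₁
      · rcases Nat.lt_succ_iff_lt_or_eq.1 hi with hi | hi
        · have := hLov₁ i h hi
          unfold LovaszTestAt at this ⊢
          rwa [h1, h2 _ (fun h' => by have := congrArg Fin.val h'; simp [hkdef] at this; omega)]
        · obtain rfl : i = j₀ := Fin.ext (by simp [hj₀def]; omega)
          have hk' : (⟨(j₀ : ℕ) + 1, h⟩ : Fin n) = k := Fin.ext (by simp [hj₀def, hkdef]; omega)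
          rw [hk']
          unfold LovaszTestAt at ht ⊢
          rwa [h1, h3 _ le_rfl]
    · rw [if_neg ht]
      dsimp only
      -- the new family agrees with the old one below `k - 1`
      have hagree : ∀ l : Fin n, (l : ℕ) < s.k - 1 → (b₁ ∘ Equiv.swap j₀ k) l = s.b l := by
        intro l hl
        have hlj : l ≠ j₀ := fun h' => by have := congrArg Fin.val h'; simp [hj₀def] at this; omega
        have hlk : l ≠ k := fun h' => by have := congrArg Fin.val h'; simp [hkdef] at this; omega
        rw [comp_apply, Equiv.swap_apply_of_ne_of_ne hlj hlk, hb₁def, lllSizeReduce]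
        split_ifs
        · rfl
        · rw [update_of_ne hlk]
      refine ⟨fun i j hji hi => ?_, fun i h hi => ?_⟩
      · have hi' : (i : ℕ) < s.k - 1 := by
          rcases Nat.lt_or_ge 1 (s.k - 1 + 1) with h1 | h1 <;> omega
        rw [gsCoeff_congr_of_forall_le (g := ⇑φ ∘ s.b) fun l hl => by
          rw [max_eq_left hji.le] at hl
          exact congrArg φ (hagree l (lt_of_le_of_lt hl hi'))]
        exact ha i j hji (by omega)
      · have hi' : (i : ℕ) + 1 < s.k - 1 := by omega
        rw [lovaszTestAt_congr (g := ⇑φ ∘ s.b) (Fin.le_iff_val_le_val.2 (by simp)) fun l hl => by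
          exact congrArg φ (hagree l (lt_of_le_of_lt (Fin.le_iff_val_le_val.1 hl) hi'))]
        exact hb i h (by omega)
  · rw [dif_neg hk]
    split_ifs with hlt
    · dsimp only
      refine ⟨fun i j hji hi => ?_, fun i h hi => ?_⟩
      · exact absurd (lt_of_le_of_lt (Nat.zero_le _) (Fin.lt_def.1 hji)) (by omega)
      · omega
    · exact ⟨ha, hb⟩

/-- The loop invariant holds at every iterate of the start state.
[cite: LenstraLenstraLovasz1982, §1 Fig. 1] [cite: Bremner2011, Lemma 4.13] -/
theorem iterate_lllStep_invariant (δ : ℝ) (b : Fin n → V) (t : ℕ) :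
    (∀ i j : Fin n, j < i → (i : ℕ) < ((lllStep φ δ)^[t] (lllStart b)).k →
        |gsCoeff (⇑φ ∘ ((lllStep φ δ)^[t] (lllStart b)).b) i j| ≤ 1 / 2) ∧
      (∀ (i : Fin n) (h : (i : ℕ) + 1 < n), (i : ℕ) + 1 < ((lllStep φ δ)^[t] (lllStart b)).k →
        LovaszTestAt δ (⇑φ ∘ ((lllStep φ δ)^[t] (lllStart b)).b) i ⟨i + 1, h⟩) := by
  induction t with
  | zero =>
    refine ⟨fun i j hji hi => ?_, fun i h hi => ?_⟩
    · simp only [iterate_zero, id_eq, lllStart] at hi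
      exact absurd (lt_of_le_of_lt (Nat.zero_le _) (Fin.lt_def.1 hji)) (by omega)
    · simp only [iterate_zero, id_eq, lllStart] at hi
      omega
  | succ t ih =>
    rw [iterate_succ_apply']
    exact lllStep_invariant φ δ _ ih.1 ih.2

/-- **Discharge of `isLLLReduced_of_halted`** (LLL82 §1; Bremner Lemma 4.13): a halted iterate
of the start state carries an LLL-reduced family.
[cite: LenstraLenstraLovasz1982, §1 Fig. 1 and Prop. 1.26] [cite: Bremner2011, Lemma 4.13] -/
theorem isLLLReduced_of_halted_holds : isLLLReduced_of_halted φ := by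
  intro n δ b t ht
  obtain ⟨h1, h2⟩ := iterate_lllStep_invariant φ δ b t
  exact ⟨fun i j hji => h1 i j hji (lt_of_lt_of_le i.isLt ht),
    fun i h => h2 i h (lt_of_lt_of_le h ht)⟩

end Invariant

end Literature.Algebra.EuclideanLattices
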